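import Summits.BirchSwinnertonDyer.BirchSwinnertonDyer.Theorems.RamifiedHeegnerPairGss2LowerAtThreeRankOneKolyvaginRoad
import Summits.BirchSwinnertonDyer.BirchSwinnertonDyer.Theses.RamifiedHeegnerPair
import Summits.BirchSwinnertonDyer.Rank1Residual.X11b.Three.StepLAtThree
import HarnessLib

/-!
# Route `RamifiedHeegnerPair`, deciding crux L₁ `Gss2LowerAtThreeRankOne` (stmt-BirchSwinnertonDyer-26021) — the split-field
# Kolyvagin road with its load-bearing input in EXISTENTIAL form: ONE split Heegner datum per curve suffices

HONEST FRAMING. Theorems only; helper file (`--supports stmt-BirchSwinnertonDyer-26021`); no definition, no named fact, no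
`sorry`; nothing is booked, no item is closed, BSD is not proved for any curve; CONDITIONAL on every displayed input. Lead
prover bsd-line-rhp-p1 g3, 2026-08-28. Sequel of `…KolyvaginRoad.lean` (p610432) / `…KolyvaginRoadByName.lean` (p610796).

WHY. There the load-bearing input (the BSD-consistent ADJUSTED STEP L at `3`,
`2·ord₃[E(K′):ℤP] ≤ ord₃ #Ш(E/K′) + ord₃∏c(E) + ord₃∏c(Wd) + 2·ord₃ c(Dt)`) is asked at EVERY Heegner datum of every split
Heegner field of the row, and the class-level theorem picks its own field (Friedberg–Hoffstein) and datum (modularity). But the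
pointwise door `missingLowerBoundAt_three_rankOne_gss_of_adjustedIndexBound` consumes ONE datum. So the honest minimal neck of
the line is EXISTENTIAL: for every Gss2 rank-one 3-adic-tower row, SOME imaginary quadratic `K′` satisfying the Heegner
hypothesis for `N_E` with `L(E^{(d_{K′})},1) ≠ 0`, SOME datum `(Dt, H, ι)` at level `N_E` with its Heegner point `P ∈ E(K′)`, SOME
globally minimal model `Wd` of the twist, at which the adjusted bound holds (granted `Ш(E/K′)` finite). This is (a) weaker than
the `∀`-form modulo the published existence theorems, (b) exactly what a per-pair CERTIFICATE delivers (choose the field and the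
datum, exhibit one Kolyvagin class — Jetchev–Lauter–Stein 2009 §4), (c) still implied by the Iwasawa-side road (IMC ⊇ + BDP give
it at every datum). With it the published binders shrink to {Gross–Zagier, Kolyvagin, Kato 14.5(3)+14.16(2) Tamagawa-exact,
GZK, modularity-as-analytic-continuation}: Friedberg–Hoffstein, the newform and the parametrisation-existence facts move INTO
the witness. `3 ∤ #𝓞_{K′}^×` is automatic (`3 ∣ N_E` splits in `K′`, so `d_{K′} ≠ −3`:
`X11b.Three.not_dvd_discr_and_not_dvd_torsionOrder_of_heegner`).

* §5 `gssLowerAtThree_rankOne_towerRows_of_exists_adjustedIndexBound` — L₁ on the tower rows ⟸ PUB₅ ∧ [∃ datum with the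
  adjusted bound, per row];
* §6 `gssLowerAtThree_rankOne_towerRows_of_structure_of_exists_indivisibility` — the same with the witness carrying, instead
  of the bound, a budget `m` (`2m ≤ ord₃∏c(E) + ord₃∏c(Wd) + 2·ord₃ c(Dt)`) and ONE genuine Kolyvagin class not
  `3^{m+1}`-divisible (`¬ AdditiveThree.MinftyGe … (m+1)`), under Kolyvagin's structure theorem, lower one-class form
  (`AdditiveThree.OneClassLowerBoundShape`) — the per-pair certificate shape; `d_{K′} ∉ {−3, −4}` and the non-torsion of
  `P` are derived (Heegner hypothesis at `3 ∣ N_E`; Gross–Zagier);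
* §7 the crux BY NAME in both forms, non-tower rows displayed
  (`gss2LowerAtThreeRankOne_of_exists_adjustedIndexBound_of_nonTower`, `…_of_structure_of_exists_indivisibility_of_nonTower`).

References: [cite: JetchevSkinnerWan2017, §7.4.1 (arXiv:1512.06894 pp. 29–31)] [cite: Kato2004Asterisque, Thm. 14.5 (3) (p. 236),
Prop. 14.16 (2) (p. 244)] [cite: McCallumLMS1991, Thm. 5.4 (p. 288), Thm. 5.8 (p. 290)] [cite: WZhang2014, Thm. 1.1, §3.8, Thm. 10.2,
Remark 18] [cite: JetchevLauterStein2009, Prop. 4.1–4.2] [cite: GrossZagier1986, Thm. I.(6.3) and V.§2] [cite: Miller2011LMS, Def. 1.1].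
-/

-- D-0017: single-problem summit, so `Summit.BirchSwinnertonDyer.BirchSwinnertonDyer.…` repeats a namespace BY DESIGN.
set_option linter.dupNamespace false
set_option autoImplicit false

noncomputable section

open scoped Classical NumberField

open WeierstrassCurve NumberField IsDedekindDomain
  Literature.NumberTheory.EllipticCurves Literature.NumberTheory.EllipticCurves.ModularForms
  Literature.NumberTheory.EllipticCurves.Rank1Residual
  Literature.NumberTheory.EllipticCurves.Rank1Residual.Typed
  Summit.BirchSwinnertonDyer.Rank1Residual
  Summit.BirchSwinnertonDyer.Rank1Residual.Additive
  Summit.BirchSwinnertonDyer.Rank1Residual.X11b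
  Summit.BirchSwinnertonDyer.Rank1Residual.GaloisImage
  Literature.NumberTheory.Automorphic

namespace Summit.BirchSwinnertonDyer.BirchSwinnertonDyer.Theorems.RamifiedPairLowerBound

/-! ## §5 L₁ on the tower rows from PUB₅ + ONE datum per row carrying the adjusted STEP L -/

/-- **L₁ on the tower rows ⟸ PUB₅ ∧ «for every row, SOME split Heegner datum with the ADJUSTED STEP L at 3».** PUBLISHED
binders: `hGZ` (Gross–Zagier), `hKo` (Kolyvagin, qualitative), `hKatoT` (Kato 2004 Thm. 14.5 (3) + Prop. 14.16 (2),
Tamagawa-exact, additive potentially good prime — for the rank-`0` twist), `hGZK`, `hmod`. TYPED INPUT `hEx`: for every globally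
minimal `E/ℚ` additive (G) ∧ ss at `3` with `r_an(E) = 1` and `ρ_{E,3^n}` onto for all `n`, a witness `(N = N_E, K′, Dt, H, ι, P,
Wd, Cd)` — `K′` imaginary quadratic, Heegner for `N_E`, `L(E^{(d_{K′})},1) ≠ 0`, `P ∈ E(K′)` over the complex Heegner point of
`(Dt, H, ι)`, `Wd = Cd • E^{(d_{K′})}` globally minimal — with `2·ord₃[E(K′):ℤP] ≤ ord₃ #Ш(E/K′) + ord₃∏c(E) + ord₃∏c(Wd) +
2·ord₃ c(Dt)` granted `Ш(E/K′)` finite. CONCLUSION: `Typed.MissingLowerBoundAt E 3` on all those rows (§0 door; `3 ∤ #𝓞_{K′}^×`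
is automatic). [cite: JetchevSkinnerWan2017, §7.4.1 (pp. 29–31)] [cite: Kato2004Asterisque, Thm. 14.5 (3) (p. 236)]
[cite: Miller2011LMS, Def. 1.1] -/
theorem gssLowerAtThree_rankOne_towerRows_of_exists_adjustedIndexBound
    (hGZ : ∀ (N : ℕ) [NeZero N] (W : WeierstrassCurve ℚ) (K : Type) [Field K] [NumberField K],
      gross_zagier N W K)
    (hKo : ∀ (N : ℕ) [NeZero N] (W : WeierstrassCurve ℚ) (K : Type) [Field K] [NumberField K],
      kolyvagin N W K)
    (hKatoT : Kato2004.rankZero_padicValNat_sha_add_padicValNat_tamagawa_le_of_additive_potGood_of_imageContainsSL2)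
    (hGZK : rank_eq_analyticRank_of_analyticRank_le_one) (hmod : hasEntireLFunction_rat)
    (hEx : ∀ (W : WeierstrassCurve ℚ) [W.IsElliptic] [W.IsGloballyMinimal],
      Addv W 3 → SubGss W 3 → W.analyticRank = 1 → (∀ n : ℕ, W.HasSurjectiveModNGaloisRep (3 ^ n : ℕ)) →
      ∃ (N : ℕ) (_ : NeZero N) (K : Type) (_ : Field K) (_ : NumberField K)
        (Dt : ModularParametrizationData W N) (H : HeegnerDatum N (NumberField.discr K)) (ι : K →+* ℂ)
        (P : (W.baseChange K).toAffine.Point)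
        (Wd : WeierstrassCurve ℚ) (_ : Wd.IsElliptic) (_ : Wd.IsGloballyMinimal) (Cd : VariableChange ℚ),
        W.conductorNorm ℤ = N ∧ IsImaginaryQuadratic K ∧ SatisfiesHeegnerHypothesis N K ∧
        (W.quadraticTwist (NumberField.discr K : ℚ)).entireLFunction 1 ≠ 0 ∧
        WeierstrassCurve.Affine.Point.map ι.toRatAlgHom P = heegnerPointComplex Dt H ∧
        Cd • W.quadraticTwist (NumberField.discr K : ℚ) = Wd ∧
        (Finite (W.baseChange K).sha →
          (2 * padicValNat 3 (AddSubgroup.zmultiples P).index : ℤ) ≤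
            padicValNat 3 (W.baseChange K).shaOrder + padicValNat 3 W.tamagawaProduct +
              padicValNat 3 Wd.tamagawaProduct + 2 * padicValRat 3 (Dt.c : ℚ))) :
    ∀ (W : WeierstrassCurve ℚ) [W.IsElliptic] [W.IsGloballyMinimal],
      Addv W 3 → SubGss W 3 → W.analyticRank = 1 →
      (∀ n : ℕ, W.HasSurjectiveModNGaloisRep (3 ^ n : ℕ)) → MissingLowerBoundAt W 3 := by
  intro W _ _ hadd hsub hr hsurj
  obtain ⟨N, hN0, K, _, _, Dt, H, ι, P, Wd, _, _, Cd, hN, hK, hHN, hLt, hP, hWd, hL'⟩ := hEx W hadd hsub hr hsurj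
  haveI : NeZero N := hN0
  subst hN
  -- `3 ∣ N_E` splits in `K`: `3 ∤ #𝓞_K^×`
  have h3N : 3 ∣ W.conductorNorm ℤ :=
    (W.dvd_conductorNorm_iff_not_hasGoodReductionAtPrime 3).mpr (not_good_of_addv W 3 hadd)
  have hμ : ¬ 3 ∣ Units.torsionOrder K :=
    (X11b.Three.not_dvd_discr_and_not_dvd_torsionOrder_of_heegner hK hHN (by decide) h3N).2
  exact missingLowerBoundAt_three_rankOne_gss_of_adjustedIndexBound W K Dt H ι P (hGZ _ W K) (hKo _ W K) hKatoT hGZK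
    hmod hadd hsub hr hsurj hK hHN hP hμ hLt Wd Cd hWd hL'

/-! ## §6 The per-pair CERTIFICATE shape: ONE datum with ONE indivisible Kolyvagin class within the BSD budget -/

/-- **L₁ on the tower rows ⟸ PUB₅ ∧ structure (lower one-class form) ∧ «for every row, SOME split Heegner datum with ONE
genuine Kolyvagin class not `3^{m+1}`-divisible for a budget `2m ≤ ord₃∏c(E) + ord₃∏c(Wd) + 2·ord₃ c(Dt)`».** The per-pair
CERTIFICATE shape of the road (Jetchev–Lauter–Stein 2009 §4: exhibit `P_ℓ` resp. `c_M(ℓ)` modulo `3^{m+1}`); `d_{K′} ∉ {−3,−4}`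
(Heegner hypothesis at `3 ∣ N_E`: `3 ∤ d_{K′}`; `4N_E ∣ β² − d_{K′}` excludes `−4` since `2` is no square mod `3`) and the
non-torsion of `P` (Gross–Zagier: `L′(E/K′,1) = L′(E,1)·L(E^{d_{K′}},1) ≠ 0`) are DERIVED, so the witness carries data only.
`hSL` = `AdditiveThree.OneClassLowerBoundShape` (McCallum 1991 Thm. 5.4/5.8, print-shaped, hypothesis).
[cite: McCallumLMS1991, Thm. 5.4 (p. 288), Thm. 5.8 (p. 290)] [cite: JetchevLauterStein2009, Prop. 4.1–4.2]
[cite: WZhang2014, §3.8 (p. 213), Thm. 10.2, Remark 18] [cite: GrossZagier1986, Thm. I.(6.3) and V.§2] -/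
theorem gssLowerAtThree_rankOne_towerRows_of_structure_of_exists_indivisibility
    (hGZ : ∀ (N : ℕ) [NeZero N] (W : WeierstrassCurve ℚ) (K : Type) [Field K] [NumberField K],
      gross_zagier N W K)
    (hKo : ∀ (N : ℕ) [NeZero N] (W : WeierstrassCurve ℚ) (K : Type) [Field K] [NumberField K],
      kolyvagin N W K)
    (hKatoT : Kato2004.rankZero_padicValNat_sha_add_padicValNat_tamagawa_le_of_additive_potGood_of_imageContainsSL2)
    (hGZK : rank_eq_analyticRank_of_analyticRank_le_one) (hmod : hasEntireLFunction_rat)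
    (hSL : AdditiveThree.OneClassLowerBoundShape)
    (hEx : ∀ (W : WeierstrassCurve ℚ) [W.IsElliptic] [W.IsGloballyMinimal] [NeZero (W.conductorNorm ℤ)],
      Addv W 3 → SubGss W 3 → W.analyticRank = 1 → (∀ n : ℕ, W.HasSurjectiveModNGaloisRep (3 ^ n : ℕ)) →
      ∃ (K : Type) (_ : Field K) (_ : NumberField K)
        (Dt : ModularParametrizationData W (W.conductorNorm ℤ))
        (H : HeegnerDatum (W.conductorNorm ℤ) (NumberField.discr K)) (ι : K →+* ℂ)
        (P : (W.baseChange K).toAffine.Point)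
        (Wd : WeierstrassCurve ℚ) (_ : Wd.IsElliptic) (_ : Wd.IsGloballyMinimal) (Cd : VariableChange ℚ) (m : ℕ),
        IsImaginaryQuadratic K ∧ SatisfiesHeegnerHypothesis (W.conductorNorm ℤ) K ∧
        (W.quadraticTwist (NumberField.discr K : ℚ)).entireLFunction 1 ≠ 0 ∧
        WeierstrassCurve.Affine.Point.map ι.toRatAlgHom P = heegnerPointComplex Dt H ∧
        Cd • W.quadraticTwist (NumberField.discr K : ℚ) = Wd ∧
        2 * m ≤ padicValNat 3 W.tamagawaProduct + padicValNat 3 Wd.tamagawaProduct + 2 * padicValNat 3 Dt.c.natAbs ∧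
        ¬ AdditiveThree.MinftyGe W K Dt H.β ι (m + 1)) :
    ∀ (W : WeierstrassCurve ℚ) [W.IsElliptic] [W.IsGloballyMinimal],
      Addv W 3 → SubGss W 3 → W.analyticRank = 1 →
      (∀ n : ℕ, W.HasSurjectiveModNGaloisRep (3 ^ n : ℕ)) → MissingLowerBoundAt W 3 := by
  refine gssLowerAtThree_rankOne_towerRows_of_exists_adjustedIndexBound hGZ hKo hKatoT hGZK hmod ?_
  intro W _ _ hadd hsub hr hsurj
  haveI hN0 : NeZero (W.conductorNorm ℤ) := ⟨(W.conductorNorm_pos_holds).ne'⟩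
  obtain ⟨K, _, _, Dt, H, ι, P, Wd, _, _, Cd, m, hK, hHN, hLt, hP, hWd, hm, hnot⟩ := hEx W hadd hsub hr hsurj
  refine ⟨W.conductorNorm ℤ, hN0, K, inferInstance, inferInstance, Dt, H, ι, P, Wd, inferInstance, inferInstance, Cd, rfl,
    hK, hHN, hLt, hP, hWd, fun _ ↦ ?_⟩
  -- `d_K ∉ {−3, −4}` from the Heegner hypothesis at `3 ∣ N_E`
  have h3N : 3 ∣ W.conductorNorm ℤ :=
    (W.dvd_conductorNorm_iff_not_hasGoodReductionAtPrime 3).mpr (not_good_of_addv W 3 hadd)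
  have hd3 : ¬ ((3 : ℕ) : ℤ) ∣ NumberField.discr K :=
    not_dvd_discr_of_satisfiesHeegnerHypothesis hK hHN Nat.prime_three h3N
  have h3 : NumberField.discr K ≠ -3 := fun h ↦ hd3 (h ▸ ⟨-1, by norm_num⟩)
  have h4 : NumberField.discr K ≠ -4 := by
    intro hK4
    have h12 : (3 : ℤ) ∣ 4 * (W.conductorNorm ℤ : ℤ) := Dvd.dvd.mul_left (by exact_mod_cast h3N) 4
    have h3d : (3 : ℤ) ∣ H.β ^ 2 - NumberField.discr K := dvd_trans h12 H.dvd_sq_sub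
    have hcast : ((H.β ^ 2 - NumberField.discr K : ℤ) : ZMod 3) = 0 :=
      (ZMod.intCast_zmod_eq_zero_iff_dvd _ 3).mpr h3d
    have hdK : ((NumberField.discr K : ℤ) : ZMod 3) = -4 := by rw [hK4]; push_cast; ring
    push_cast at hcast
    rw [hdK] at hcast
    have key : ∀ b : ZMod 3, b ^ 2 - (-4 : ZMod 3) ≠ 0 := by decide
    exact key _ hcast
  -- non-torsion of the Heegner point (Gross–Zagier)
  have hL0 : W.entireLFunction 1 = 0 := entireLFunction_one_eq_zero_of_analyticRank_eq_one hr
  obtain ⟨-, hderiv⟩ := leadingLCoeff_eq_deriv_of_analyticRank_eq_one hr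
  have hLK : LDerivEK W K ≠ 0 := by
    rw [KrizLi2019.lDerivEK_eq_deriv_mul W K hmod hL0]; exact mul_ne_zero hderiv hLt
  have hnt : ¬ IsOfFinAddOrder P :=
    (lDerivEK_ne_zero_iff_not_isOfFinAddOrder W (W.conductorNorm ℤ) K (hGZ _ W K) hK hHN ⟨Dt, H, ι, hP⟩).mp hLK
  exact adjustedIndexBound_three_of_oneClassLowerBound_of_not_minftyGe hSL W hsurj K hK h3 h4 hHN Dt H ι P hP hnt Wd
    ⟨m, hm, hnot⟩

/-! ## §7 The crux BY NAME, existential inputs, non-tower rows displayed -/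

/-- **26021 BY NAME ⟸ PUB₅ ∧ [∃ split Heegner datum with the adjusted STEP L, per tower row] ∧ [L₁ on the non-tower rows].**
An honest split by the 3-adic image; closes nothing. [cite: JetchevSkinnerWan2017, §7.4.1 (pp. 29–31)] [cite: Miller2011LMS, Def. 1.1] -/
theorem gss2LowerAtThreeRankOne_of_exists_adjustedIndexBound_of_nonTower
    (hGZ : ∀ (N : ℕ) [NeZero N] (W : WeierstrassCurve ℚ) (K : Type) [Field K] [NumberField K],
      gross_zagier N W K)
    (hKo : ∀ (N : ℕ) [NeZero N] (W : WeierstrassCurve ℚ) (K : Type) [Field K] [NumberField K],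
      kolyvagin N W K)
    (hKatoT : Kato2004.rankZero_padicValNat_sha_add_padicValNat_tamagawa_le_of_additive_potGood_of_imageContainsSL2)
    (hGZK : rank_eq_analyticRank_of_analyticRank_le_one) (hmod : hasEntireLFunction_rat)
    (hEx : ∀ (W : WeierstrassCurve ℚ) [W.IsElliptic] [W.IsGloballyMinimal],
      Addv W 3 → SubGss W 3 → W.analyticRank = 1 → (∀ n : ℕ, W.HasSurjectiveModNGaloisRep (3 ^ n : ℕ)) →
      ∃ (N : ℕ) (_ : NeZero N) (K : Type) (_ : Field K) (_ : NumberField K)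
        (Dt : ModularParametrizationData W N) (H : HeegnerDatum N (NumberField.discr K)) (ι : K →+* ℂ)
        (P : (W.baseChange K).toAffine.Point)
        (Wd : WeierstrassCurve ℚ) (_ : Wd.IsElliptic) (_ : Wd.IsGloballyMinimal) (Cd : VariableChange ℚ),
        W.conductorNorm ℤ = N ∧ IsImaginaryQuadratic K ∧ SatisfiesHeegnerHypothesis N K ∧
        (W.quadraticTwist (NumberField.discr K : ℚ)).entireLFunction 1 ≠ 0 ∧
        WeierstrassCurve.Affine.Point.map ι.toRatAlgHom P = heegnerPointComplex Dt H ∧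
        Cd • W.quadraticTwist (NumberField.discr K : ℚ) = Wd ∧
        (Finite (W.baseChange K).sha →
          (2 * padicValNat 3 (AddSubgroup.zmultiples P).index : ℤ) ≤
            padicValNat 3 (W.baseChange K).shaOrder + padicValNat 3 W.tamagawaProduct +
              padicValNat 3 Wd.tamagawaProduct + 2 * padicValRat 3 (Dt.c : ℚ)))
    (hNT : ∀ (W : WeierstrassCurve ℚ) [W.IsElliptic] [W.IsGloballyMinimal],
      ¬ W.HasCM → Addv W 3 → SubGss W 3 → W.analyticRank = 1 →
      ¬ (∀ n : ℕ, W.HasSurjectiveModNGaloisRep (3 ^ n : ℕ)) → MissingLowerBoundAt W 3) :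
    Summit.BirchSwinnertonDyer.BirchSwinnertonDyer.Theses.RamifiedHeegnerPair.Gss2LowerAtThreeRankOne := by
  intro W _ _ hCM hadd hsub hr
  by_cases hρ : ∀ n : ℕ, W.HasSurjectiveModNGaloisRep (3 ^ n : ℕ)
  · exact gssLowerAtThree_rankOne_towerRows_of_exists_adjustedIndexBound hGZ hKo hKatoT hGZK hmod hEx W hadd hsub hr hρ
  · exact hNT W hCM hadd hsub hr hρ

/-- **26021 BY NAME ⟸ PUB₅ ∧ structure (lower form) ∧ [∃ datum with ONE indivisible Kolyvagin class within budget, per tower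
row] ∧ [L₁ on the non-tower rows]** — the per-pair certificate shape of the whole crux on the tower rows. Closes nothing.
[cite: McCallumLMS1991, Thm. 5.4 (p. 288), Thm. 5.8 (p. 290)] [cite: JetchevLauterStein2009, Prop. 4.1–4.2] [cite: Miller2011LMS, Def. 1.1] -/
theorem gss2LowerAtThreeRankOne_of_structure_of_exists_indivisibility_of_nonTower
    (hGZ : ∀ (N : ℕ) [NeZero N] (W : WeierstrassCurve ℚ) (K : Type) [Field K] [NumberField K],
      gross_zagier N W K)
    (hKo : ∀ (N : ℕ) [NeZero N] (W : WeierstrassCurve ℚ) (K : Type) [Field K] [NumberField K],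
      kolyvagin N W K)
    (hKatoT : Kato2004.rankZero_padicValNat_sha_add_padicValNat_tamagawa_le_of_additive_potGood_of_imageContainsSL2)
    (hGZK : rank_eq_analyticRank_of_analyticRank_le_one) (hmod : hasEntireLFunction_rat)
    (hSL : AdditiveThree.OneClassLowerBoundShape)
    (hEx : ∀ (W : WeierstrassCurve ℚ) [W.IsElliptic] [W.IsGloballyMinimal] [NeZero (W.conductorNorm ℤ)],
      Addv W 3 → SubGss W 3 → W.analyticRank = 1 → (∀ n : ℕ, W.HasSurjectiveModNGaloisRep (3 ^ n : ℕ)) →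
      ∃ (K : Type) (_ : Field K) (_ : NumberField K)
        (Dt : ModularParametrizationData W (W.conductorNorm ℤ))
        (H : HeegnerDatum (W.conductorNorm ℤ) (NumberField.discr K)) (ι : K →+* ℂ)
        (P : (W.baseChange K).toAffine.Point)
        (Wd : WeierstrassCurve ℚ) (_ : Wd.IsElliptic) (_ : Wd.IsGloballyMinimal) (Cd : VariableChange ℚ) (m : ℕ),
        IsImaginaryQuadratic K ∧ SatisfiesHeegnerHypothesis (W.conductorNorm ℤ) K ∧
        (W.quadraticTwist (NumberField.discr K : ℚ)).entireLFunction 1 ≠ 0 ∧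
        WeierstrassCurve.Affine.Point.map ι.toRatAlgHom P = heegnerPointComplex Dt H ∧
        Cd • W.quadraticTwist (NumberField.discr K : ℚ) = Wd ∧
        2 * m ≤ padicValNat 3 W.tamagawaProduct + padicValNat 3 Wd.tamagawaProduct + 2 * padicValNat 3 Dt.c.natAbs ∧
        ¬ AdditiveThree.MinftyGe W K Dt H.β ι (m + 1))
    (hNT : ∀ (W : WeierstrassCurve ℚ) [W.IsElliptic] [W.IsGloballyMinimal],
      ¬ W.HasCM → Addv W 3 → SubGss W 3 → W.analyticRank = 1 →
      ¬ (∀ n : ℕ, W.HasSurjectiveModNGaloisRep (3 ^ n : ℕ)) → MissingLowerBoundAt W 3) :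
    Summit.BirchSwinnertonDyer.BirchSwinnertonDyer.Theses.RamifiedHeegnerPair.Gss2LowerAtThreeRankOne := by
  intro W _ _ hCM hadd hsub hr
  by_cases hρ : ∀ n : ℕ, W.HasSurjectiveModNGaloisRep (3 ^ n : ℕ)
  · exact gssLowerAtThree_rankOne_towerRows_of_structure_of_exists_indivisibility hGZ hKo hKatoT hGZK hmod hSL hEx W hadd
      hsub hr hρ
  · exact hNT W hCM hadd hsub hr hρ

end Summit.BirchSwinnertonDyer.BirchSwinnertonDyer.Theorems.RamifiedPairLowerBound

end
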